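import Literature.AnabelianGeometry.SemiGraphs.ArithLevelDataCptCompactC
import Literature.AnabelianGeometry.SemiGraphs.ArithChartBranchActionOuter
import Literature.AnabelianGeometry.SemiGraphs.ArithBranchActionConsequences
import Literature.AnabelianGeometry.SemiGraphs.ArithChartActionAmple
import Literature.AnabelianGeometry.SemiGraphs.ArithIntersectionOfActionAt
import Literature.AnabelianGeometry.SemiGraphs.TemperedCompactInVerticialFinite
import Literature.AnabelianGeometry.SemiGraphs.ImmersionLiftUnique
import HarnessLib

/-!
# [SemiAnbd] Rmk 5.3.1 (first sentence) and Thm 5.4 (ii)'s rigidity input AT THE OUTER MODEL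
# `Π^temp_𝔊 := π₁^temp(𝒢) ⋊^out Π_A` — the two binders `hR`, `hVE` of the T54-B capstone, part (ii)

Mochizuki, *Semi-graphs of anabelioids*, Publ. RIMS **42** (2006) 221–322, §5: Rmk 5.3.1 p. 65 ("all
verticial and edge-like subgroups of `Π^temp_𝔊` are compact and arithmetically ample"), Thm 5.4 (ii)
p. 66 with the proof of Thm 3.7 (iii)/(iv) p. 41; Def 5.1 (i) p. 62; Prop 5.2 (iv) p. 64.
[cite: MochizukiSemiAnbd2006, Rmk 5.3.1, p. 65]

PROOF-ONLY file (abc-iut cell, L3 sub-DAG `plan/L3/SUBDAG-SemiAnbd-Thm54.md`, producer row T54-B,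
sub-row «T54·hR-inst» of the L3 lead's α48 (2), seat abc-iut-w4-d040 gen 4).  No definition, no new
named fact.  The T54-B capstone, second part (abc-iut-w4-d029,
`arithMaximalCompactStatementII_outerAction_piPresentation`, ArithThm54iCapstoneOuterAction.lean) takes
Rmk 5.3.1's first sentence `hR : VerticialEdgeLikeCompactAmpleStatement (decompositionDataOfChart Rc ι) aug`
and the rigidity `hVE : ∀ K, IsVerticial _ K → ¬ IsEdgeLike _ K` as explicit binders at the outer model
`E := outerSemidirectProduct ρ`, `ι := toOuterSemidirectProduct ρ`, `aug := outerSemidirectProductSnd ρ`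
(abc-iut-w4-d082 / abc-iut-L3-d2).  Here both are PRODUCED there by composition of landed theorems:

* `not_isEdgeLike_of_isVerticial_outerAction` (**hVE**): abc-iut-w4-d064's
  `not_isEdgeLike_of_isVerticial_ofChart_of_actionAt` over abc-iut-w4-d082's
  `arithChartAction_outerAction` and the exact sequence `outerAction_exact` (`ι` injective,
  `range ι = ker aug`); inputs: Thm 3.7 (iii) at `𝒢` (`CompactInVerticialAt 𝒢` — a theorem for finite
  `𝔾`, `compactInVerticialAt_of_finiteGraph`, whence the `_of_finite` form), the Thm 3.7 hypotheses, `𝔾` a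
  graph, and Prop 3.6 (iv) at `ρ_𝔾(a)` in the forms `hV`/`hE` plus Def 5.1 (i)(c) `hopen` (abc-iut-w4-d082's
  binders, print's Def 5.1 (i)(b)(c)).
* `hconjPair_outerAction`: the branch-PAIR conjugacy residual of abc-iut-w4-d029's
  `ArithChartAction.verticialEdgeLikeCompactAmple`, at the outer model, = abc-iut-w4-d064's
  `ArithChartBranchAction.hconjPair` over `arithChartBranchAction_outerAction` (abc-iut-w4-d040 gen 3) from
  the pair-level Prop 3.6 (iv) binder `hBR` (abc-iut-w4-d082) and `aug` surjective.
* `verticialEdgeLikeCompactAmple_outerAction_of_hBR` (**hR, level A**): Rmk 5.3.1 first sentence for the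
  produced data at the outer model modulo `hV`/`hE`/`hopen`/`hBR` and compactness of the representatives
  `hVc`/`hBc` — i.e. abc-iut-w6-d064's `verticialEdgeLikeCompactAmple_outerAction`
  (ArithChartActionAmpleOuter.lean, p432074) with its binder `hconjPair` DISCHARGED from `hBR`
  (re-composed here, that module's object file not being built at filing time);
  `verticialEdgeLikeCompactAmple_outerAction_of_hfin` (**hR, level B, generic**): `hVc`/`hBc` supplied by
  abc-iut-w4-d040's `hVc_of_hfin`/`hBc_of_hfin` (ArithLevelDataCptCompact.lean) over ANY compact-form level
  package `Lc` for the produced data, `E` tempered with a basis of open subgroups and finite vertex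
  stabilisers at the levels (`hfin`, honest binder);
  `verticialEdgeLikeCompactAmple_outerAction_cosetTowerC` (**hR at the capstone's package**): the same at
  `Lc := ArithLevelDataCpt.ofCosetTowerC …` (abc-iut-w4-d029 p428611) through
  `hVc_hBc_of_cosetTowerC` (ArithLevelDataCptCompactC.lean), binders = those of `ofCosetTowerC` VERBATIM
  (with `ι`/`aug` the outer model's, so `hι`, `hnorm`, `hισ`, `ker aug ≤ range ι` are DISCHARGED by
  `outerAction_exact`) + the LEVEL-B topology (`IsTempered E`, abc-iut-L3-d2's basis, `hK1′`, tree levels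
  open) + `hV`/`hE`/`hopen`/`hBR`.

So at the capstone, `hR` and `hVE` hold modulo exactly: the residual inputs of part (i), the four Prop 3.6
(iv)-at-`ρ_𝔾(a)` / Def 5.1 (i)(c) binders `hV`, `hE`, `hBR`, `hopen`, and the LEVEL-B topology binders
(`IsTempered E` with the displayed basis, `Π_A` compact, `hK1′`, `K n` open).  Nothing here takes a side on
[IUTchIII] Cor. 3.12; typed ≠ proved for the packages themselves.
-/

namespace Literature.AnabelianGeometry.SemiGraphs

namespace ProfiniteSemiGraph

open Literature.AnabelianGeometry.EtaleTheta CategoryTheory Topology Filter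
open scoped Pointwise

universe v u w

variable {𝒢 : ProfiniteSemiGraph.{u}} (c : TemperedPiChart 𝒢)
  {PA : Type w} [Group PA] [TopologicalSpace PA] (ρ : PA →* TopOut c.G) (baseAct : PA →* Aut 𝒢.graph)

/-! ### `hVE`: no verticial subgroup of `π₁^temp(𝒢) ⋊^out Π_A` is edge-like -/

/-- **`hVE` at the outer model** ([SemiAnbd] Thm 5.4 (ii) via Thm 3.7 (iv), p. 66/p. 41): for the
decomposition data produced from the chart `c` inside `Π^temp_𝔊 := π₁^temp(𝒢) ⋊^out Π_A`, no verticial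
subgroup is edge-like — given Thm 3.7 (iii) at `𝒢` (`CompactInVerticialAt`), the Thm 3.7 hypotheses, `𝔾` a
graph, and Prop 3.6 (iv) at `ρ_𝔾(a)` (`hV`, `hE`) with Def 5.1 (i)(c) (`hopen`).  Composition of
`not_isEdgeLike_of_isVerticial_ofChart_of_actionAt` (abc-iut-w4-d064), `arithChartAction_outerAction`
(abc-iut-w4-d082) and `outerAction_exact`. [cite: MochizukiSemiAnbd2006, Thm 5.4 (ii), p. 66] -/
theorem not_isEdgeLike_of_isVerticial_outerAction (h : CompactInVerticialAt 𝒢)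
    (h𝒢 : 𝒢.Thm37Hypotheses) (hG : 𝒢.graph.IsGraph) (R : ChartRepresentatives c)
    (hV : ∀ (a : PA) (v : 𝒢.graph.Vertex) (H : Subgroup c.G), H ∈ verticialSubgroups c v →
      ∃ φ : contMulAut c.G, TopOut.mk c.G φ = ρ a ∧
        H.map (φ : MulAut c.G).toMonoidHom ∈ verticialSubgroups c ((baseAct a).hom.vertexMap v))
    (hE : ∀ (a : PA) (e : 𝒢.graph.Edge) (K : Subgroup c.G), K ∈ edgeLikeSubgroups c e →
      ∃ φ : contMulAut c.G, TopOut.mk c.G φ = ρ a ∧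
        K.map (φ : MulAut c.G).toMonoidHom ∈ edgeLikeSubgroups c ((baseAct a).hom.edgeMap e))
    (hopen : ∃ U : Subgroup PA, IsOpen (U : Set PA) ∧ ∀ a ∈ U,
      (∀ v, (baseAct a).hom.vertexMap v = v) ∧ (∀ e, (baseAct a).hom.edgeMap e = e) ∧
        ∀ b, (baseAct a).hom.branchMap b = b)
    (K : Subgroup (outerSemidirectProduct ρ))
    (hK : IsVerticial (decompositionDataOfChart R (toOuterSemidirectProduct ρ)) K) :
    ¬ IsEdgeLike (decompositionDataOfChart R (toOuterSemidirectProduct ρ)) K := by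
  obtain ⟨hι, hex, -⟩ := outerAction_exact c ρ h𝒢.toProp36Hypotheses
  exact not_isEdgeLike_of_isVerticial_ofChart_of_actionAt h h𝒢 hG R (toOuterSemidirectProduct ρ) hι
    (outerSemidirectProductSnd ρ) hex (arithChartAction_outerAction c ρ baseAct hV hE hopen) hK

/-- **`hVE` at the outer model for FINITE `𝔾`** (the frame of the T54-B capstone: `[Finite Vertex]`,
`[Finite Branch]`): Thm 3.7 (iii) at `𝒢` is then the tree's theorem `compactInVerticialAt_of_finiteGraph`
(abc-iut-w4-d064 / abc-iut-L3-t11), so no verticial subgroup of `π₁^temp(𝒢) ⋊^out Π_A` is edge-like modulo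
only `hV`/`hE`/`hopen`. [cite: MochizukiSemiAnbd2006, Thm 5.4 (ii), p. 66] -/
theorem not_isEdgeLike_of_isVerticial_outerAction_of_finite [Finite 𝒢.graph.Vertex]
    [Finite 𝒢.graph.Branch] (h𝒢 : 𝒢.Thm37Hypotheses) (hG : 𝒢.graph.IsGraph) (R : ChartRepresentatives c)
    (hV : ∀ (a : PA) (v : 𝒢.graph.Vertex) (H : Subgroup c.G), H ∈ verticialSubgroups c v →
      ∃ φ : contMulAut c.G, TopOut.mk c.G φ = ρ a ∧
        H.map (φ : MulAut c.G).toMonoidHom ∈ verticialSubgroups c ((baseAct a).hom.vertexMap v))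
    (hE : ∀ (a : PA) (e : 𝒢.graph.Edge) (K : Subgroup c.G), K ∈ edgeLikeSubgroups c e →
      ∃ φ : contMulAut c.G, TopOut.mk c.G φ = ρ a ∧
        K.map (φ : MulAut c.G).toMonoidHom ∈ edgeLikeSubgroups c ((baseAct a).hom.edgeMap e))
    (hopen : ∃ U : Subgroup PA, IsOpen (U : Set PA) ∧ ∀ a ∈ U,
      (∀ v, (baseAct a).hom.vertexMap v = v) ∧ (∀ e, (baseAct a).hom.edgeMap e = e) ∧
        ∀ b, (baseAct a).hom.branchMap b = b) :
    ∀ K : Subgroup (outerSemidirectProduct ρ),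
      IsVerticial (decompositionDataOfChart R (toOuterSemidirectProduct ρ)) K →
        ¬ IsEdgeLike (decompositionDataOfChart R (toOuterSemidirectProduct ρ)) K := by
  haveI : Finite 𝒢.graph.Edge := SemiGraph.finite_edge_of_finite_branch 𝒢.graph
  exact fun K hK => not_isEdgeLike_of_isVerticial_outerAction c ρ baseAct
    compactInVerticialAt_of_finiteGraph h𝒢 hG R hV hE hopen K hK

/-! ### `hconjPair` and `hR` (Rmk 5.3.1, first sentence) at the outer model -/

/-- **The branch-PAIR conjugacy residual `hconjPair` at the outer model** ([SemiAnbd] Def 5.1 (i) /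
Rmk 5.3.1 pp. 62, 65): for a branch `b` abutting to `v` there is an open `U ≤ Π_A` such that every `a ∈ U`
lifts to some `g ∈ π₁^temp(𝒢) ⋊^out Π_A` conjugating the pair (`ι Π^temp_{𝔾,v}`, `ι Π^temp_{𝔾,b}`) like some
`ι h` — from the pair-level Prop 3.6 (iv) binder `hBR` via `arithChartBranchAction_outerAction`
(abc-iut-w4-d040) and `ArithChartBranchAction.hconjPair` (abc-iut-w4-d064), `aug` being surjective
(`outerSemidirectProductSnd_surjective`). [cite: MochizukiSemiAnbd2006, Rmk 5.3.1, p. 65] -/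
theorem hconjPair_outerAction (h : CompactInVerticialAt 𝒢) (h𝒢 : 𝒢.Thm37Hypotheses)
    (hG : 𝒢.graph.IsGraph) (R : ChartRepresentatives c)
    (hV : ∀ (a : PA) (v : 𝒢.graph.Vertex) (H : Subgroup c.G), H ∈ verticialSubgroups c v →
      ∃ φ : contMulAut c.G, TopOut.mk c.G φ = ρ a ∧
        H.map (φ : MulAut c.G).toMonoidHom ∈ verticialSubgroups c ((baseAct a).hom.vertexMap v))
    (hE : ∀ (a : PA) (e : 𝒢.graph.Edge) (K : Subgroup c.G), K ∈ edgeLikeSubgroups c e →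
      ∃ φ : contMulAut c.G, TopOut.mk c.G φ = ρ a ∧
        K.map (φ : MulAut c.G).toMonoidHom ∈ edgeLikeSubgroups c ((baseAct a).hom.edgeMap e))
    (hopen : ∃ U : Subgroup PA, IsOpen (U : Set PA) ∧ ∀ a ∈ U,
      (∀ v, (baseAct a).hom.vertexMap v = v) ∧ (∀ e, (baseAct a).hom.edgeMap e = e) ∧
        ∀ b, (baseAct a).hom.branchMap b = b)
    (hBR : ∀ (a : PA) (b : 𝒢.graph.Branch) (v : 𝒢.graph.Vertex) (hb : 𝒢.graph.abuts b = some v)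
      (φ : 𝒢.Gv v →ₜ* c.G), IsVerticialHom c v φ →
      ∃ Φ : contMulAut c.G, TopOut.mk c.G Φ = ρ a ∧
        ∃ φ' : 𝒢.Gv ((baseAct a).hom.vertexMap v) →ₜ* c.G,
          IsVerticialHom c ((baseAct a).hom.vertexMap v) φ' ∧ ∃ x' : c.G,
            Subgroup.map (Φ : MulAut c.G).toMonoidHom φ.toMonoidHom.range =
              Subgroup.map (MulAut.conj x').toMonoidHom φ'.toMonoidHom.range ∧
            Subgroup.map (Φ : MulAut c.G).toMonoidHom
                (Subgroup.map φ.toMonoidHom (𝒢.branchSubgroup b v hb)) =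
              Subgroup.map (MulAut.conj x').toMonoidHom
                (Subgroup.map φ'.toMonoidHom
                  (𝒢.branchSubgroup ((baseAct a).hom.branchMap b) ((baseAct a).hom.vertexMap v)
                    ((baseAct a).hom.abuts_branchMap b v hb))))
    (b : 𝒢.graph.Branch) (v : 𝒢.graph.Vertex) (hb : 𝒢.graph.abuts b = some v) :
    ∃ U : Subgroup PA, IsOpen (U : Set PA) ∧ ∀ a ∈ U, ∃ g : outerSemidirectProduct ρ,
      outerSemidirectProductSnd ρ g = a ∧ ∃ h : c.G,
        conjSubgroup g ((R.Hv v).map (toOuterSemidirectProduct ρ)) =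
            conjSubgroup (toOuterSemidirectProduct ρ h) ((R.Hv v).map (toOuterSemidirectProduct ρ)) ∧
          conjSubgroup g ((R.Hb b).map (toOuterSemidirectProduct ρ)) =
            conjSubgroup (toOuterSemidirectProduct ρ h) ((R.Hb b).map (toOuterSemidirectProduct ρ)) :=
  (arithChartBranchAction_outerAction c ρ baseAct hV hE hopen hBR).hconjPair h h𝒢 hG R
    (outerSemidirectProductSnd_surjective ρ) b v hb

variable [IsTopologicalGroup PA]
  [TopologicalSpace (outerSemidirectProduct ρ)] [IsTopologicalGroup (outerSemidirectProduct ρ)]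

/-- **`hR` at the outer model, LEVEL A** ([SemiAnbd] Rmk 5.3.1, first sentence, p. 65: "all verticial and
edge-like subgroups of `Π^temp_𝔊` are compact and arithmetically ample"), for the data produced from the
chart `c` inside `π₁^temp(𝒢) ⋊^out Π_A`: modulo Prop 3.6 (iv) at `ρ_𝔾(a)` (`hV`, `hE`, pair-level `hBR`),
Def 5.1 (i)(c) (`hopen`), Thm 3.7 (iii) at `𝒢`, and compactness of the representatives `hVc`/`hBc`
(level B).  `aug ∘ ι = 1` and `aug` surjective are the outer model's
`outerSemidirectProductSnd_toOuterSemidirectProduct` / `outerSemidirectProductSnd_surjective`; the rest is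
abc-iut-w4-d029's `ArithChartAction.verticialEdgeLikeCompactAmple` — abc-iut-w6-d064's
`verticialEdgeLikeCompactAmple_outerAction` (p432074) with its binder `hconjPair` := `hconjPair_outerAction`.
[cite: MochizukiSemiAnbd2006, Rmk 5.3.1, p. 65] -/
theorem verticialEdgeLikeCompactAmple_outerAction_of_hBR (h : CompactInVerticialAt 𝒢)
    (h𝒢 : 𝒢.Thm37Hypotheses)
    (hG : 𝒢.graph.IsGraph) (R : ChartRepresentatives c)
    (hV : ∀ (a : PA) (v : 𝒢.graph.Vertex) (H : Subgroup c.G), H ∈ verticialSubgroups c v →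
      ∃ φ : contMulAut c.G, TopOut.mk c.G φ = ρ a ∧
        H.map (φ : MulAut c.G).toMonoidHom ∈ verticialSubgroups c ((baseAct a).hom.vertexMap v))
    (hE : ∀ (a : PA) (e : 𝒢.graph.Edge) (K : Subgroup c.G), K ∈ edgeLikeSubgroups c e →
      ∃ φ : contMulAut c.G, TopOut.mk c.G φ = ρ a ∧
        K.map (φ : MulAut c.G).toMonoidHom ∈ edgeLikeSubgroups c ((baseAct a).hom.edgeMap e))
    (hopen : ∃ U : Subgroup PA, IsOpen (U : Set PA) ∧ ∀ a ∈ U,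
      (∀ v, (baseAct a).hom.vertexMap v = v) ∧ (∀ e, (baseAct a).hom.edgeMap e = e) ∧
        ∀ b, (baseAct a).hom.branchMap b = b)
    (hBR : ∀ (a : PA) (b : 𝒢.graph.Branch) (v : 𝒢.graph.Vertex) (hb : 𝒢.graph.abuts b = some v)
      (φ : 𝒢.Gv v →ₜ* c.G), IsVerticialHom c v φ →
      ∃ Φ : contMulAut c.G, TopOut.mk c.G Φ = ρ a ∧
        ∃ φ' : 𝒢.Gv ((baseAct a).hom.vertexMap v) →ₜ* c.G,
          IsVerticialHom c ((baseAct a).hom.vertexMap v) φ' ∧ ∃ x' : c.G,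
            Subgroup.map (Φ : MulAut c.G).toMonoidHom φ.toMonoidHom.range =
              Subgroup.map (MulAut.conj x').toMonoidHom φ'.toMonoidHom.range ∧
            Subgroup.map (Φ : MulAut c.G).toMonoidHom
                (Subgroup.map φ.toMonoidHom (𝒢.branchSubgroup b v hb)) =
              Subgroup.map (MulAut.conj x').toMonoidHom
                (Subgroup.map φ'.toMonoidHom
                  (𝒢.branchSubgroup ((baseAct a).hom.branchMap b) ((baseAct a).hom.vertexMap v)
                    ((baseAct a).hom.abuts_branchMap b v hb))))
    (hVc : ∀ v, IsCompact (arithVertGp R (toOuterSemidirectProduct ρ) v : Set (outerSemidirectProduct ρ)))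
    (hBc : ∀ b, IsCompact (arithBrGp R (toOuterSemidirectProduct ρ) b : Set (outerSemidirectProduct ρ))) :
    VerticialEdgeLikeCompactAmpleStatement (decompositionDataOfChart R (toOuterSemidirectProduct ρ))
      (outerSemidirectProductSnd ρ) :=
  (arithChartAction_outerAction c ρ baseAct hV hE hopen).verticialEdgeLikeCompactAmple R
    (outerSemidirectProductSnd_toOuterSemidirectProduct ρ) (outerSemidirectProductSnd_surjective ρ) hG
    (hconjPair_outerAction c ρ baseAct h h𝒢 hG R hV hE hopen hBR) hVc hBc

/-- **`hR` at the outer model, LEVEL B, generic form** ([SemiAnbd] Rmk 5.3.1, first sentence, p. 65): as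
`verticialEdgeLikeCompactAmple_outerAction_of_hBR`, the compactness of the representatives being SUPPLIED by
abc-iut-w4-d040's `hVc_of_hfin` / `hBc_of_hfin` over ANY compact-form arithmetic level package `Lc` for the
produced data, `π₁^temp(𝒢) ⋊^out Π_A` tempered with a basis `(V i)` of open subgroups at `1` and, for every
`i`, some tree level of `Lc` with all vertex stabilisers of finite image modulo `V i` (`hfin`, honest binder —
discharged in coset-tower currency by `hfin_of_cosetTower`, modulo `hK1′`).
[cite: MochizukiSemiAnbd2006, Rmk 5.3.1, p. 65] -/
theorem verticialEdgeLikeCompactAmple_outerAction_of_hfin (h : CompactInVerticialAt 𝒢)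
    (h𝒢 : 𝒢.Thm37Hypotheses) (hG : 𝒢.graph.IsGraph) (R : ChartRepresentatives c)
    (hV : ∀ (a : PA) (v : 𝒢.graph.Vertex) (H : Subgroup c.G), H ∈ verticialSubgroups c v →
      ∃ φ : contMulAut c.G, TopOut.mk c.G φ = ρ a ∧
        H.map (φ : MulAut c.G).toMonoidHom ∈ verticialSubgroups c ((baseAct a).hom.vertexMap v))
    (hE : ∀ (a : PA) (e : 𝒢.graph.Edge) (K : Subgroup c.G), K ∈ edgeLikeSubgroups c e →
      ∃ φ : contMulAut c.G, TopOut.mk c.G φ = ρ a ∧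
        K.map (φ : MulAut c.G).toMonoidHom ∈ edgeLikeSubgroups c ((baseAct a).hom.edgeMap e))
    (hopen : ∃ U : Subgroup PA, IsOpen (U : Set PA) ∧ ∀ a ∈ U,
      (∀ v, (baseAct a).hom.vertexMap v = v) ∧ (∀ e, (baseAct a).hom.edgeMap e = e) ∧
        ∀ b, (baseAct a).hom.branchMap b = b)
    (hBR : ∀ (a : PA) (b : 𝒢.graph.Branch) (v : 𝒢.graph.Vertex) (hb : 𝒢.graph.abuts b = some v)
      (φ : 𝒢.Gv v →ₜ* c.G), IsVerticialHom c v φ →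
      ∃ Φ : contMulAut c.G, TopOut.mk c.G Φ = ρ a ∧
        ∃ φ' : 𝒢.Gv ((baseAct a).hom.vertexMap v) →ₜ* c.G,
          IsVerticialHom c ((baseAct a).hom.vertexMap v) φ' ∧ ∃ x' : c.G,
            Subgroup.map (Φ : MulAut c.G).toMonoidHom φ.toMonoidHom.range =
              Subgroup.map (MulAut.conj x').toMonoidHom φ'.toMonoidHom.range ∧
            Subgroup.map (Φ : MulAut c.G).toMonoidHom
                (Subgroup.map φ.toMonoidHom (𝒢.branchSubgroup b v hb)) =
              Subgroup.map (MulAut.conj x').toMonoidHom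
                (Subgroup.map φ'.toMonoidHom
                  (𝒢.branchSubgroup ((baseAct a).hom.branchMap b) ((baseAct a).hom.vertexMap v)
                    ((baseAct a).hom.abuts_branchMap b v hb))))
    (Lc : ArithLevelDataCpt.{v} 𝒢.graph (decompositionDataOfChart R (toOuterSemidirectProduct ρ))
      (outerSemidirectProductSnd ρ) baseAct)
    (hT : IsTempered (outerSemidirectProduct ρ)) {κ : Sort*} {p : κ → Prop}
    {V : κ → Subgroup (outerSemidirectProduct ρ)}
    (hb : (𝓝 (1 : outerSemidirectProduct ρ)).HasBasis p (fun i => (V i : Set (outerSemidirectProduct ρ))))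
    (hfin : ∀ i, p i → ∃ j : Lc.J, ∀ x : (Lc.tree j).Vertex,
      ((QuotientGroup.mk : outerSemidirectProduct ρ → outerSemidirectProduct ρ ⧸ V i) ''
        {g : outerSemidirectProduct ρ | (Lc.act j g).hom.vertexMap x = x}).Finite) :
    VerticialEdgeLikeCompactAmpleStatement (decompositionDataOfChart R (toOuterSemidirectProduct ρ))
      (outerSemidirectProductSnd ρ) :=
  verticialEdgeLikeCompactAmple_outerAction_of_hBR c ρ baseAct h h𝒢 hG R hV hE hopen hBR
    (hVc_of_hfin R (toOuterSemidirectProduct ρ) Lc hT hb hfin)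
    (hBc_of_hfin R (toOuterSemidirectProduct ρ) Lc hT hb hfin hG)

/-- **`hR` AT THE CAPSTONE'S PACKAGE `ArithLevelDataCpt.ofCosetTowerC`** ([SemiAnbd] Rmk 5.3.1, first
sentence, p. 65), i.e. the binder `hR` of abc-iut-w4-d029's
`arithMaximalCompactStatementII_outerAction_piPresentation` PRODUCED at `π₁^temp(𝒢) ⋊^out Π_A`: the binders
are those of `ArithLevelDataCpt.ofCosetTowerC` (abc-iut-w4-d029 p428611) VERBATIM with `E`, `ι`, `aug` the
outer model's — so `ι` injective, `range ι` normal, `(baseAct ∘ aug) ∘ ι = 1` and `ker aug ≤ range ι` are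
DISCHARGED by `outerAction_exact` — plus the LEVEL-B topology (`IsTempered E` with abc-iut-L3-d2's basis
`levelKer (K n) ⊓ aug⁻¹ U`, `Π_A` compact, `hK1′`, tree levels `K n` open in `π₁^temp(𝒢)`; owner of the
topology: abc-iut-w6-d070's `arithLevelTopology`) and the four Prop 3.6 (iv)-at-`ρ_𝔾(a)` / Def 5.1 (i)(c)
binders `hV`, `hE`, `hBR`, `hopen`; Thm 3.7 (iii) at the finite `𝔾` is `compactInVerticialAt_of_finiteGraph`.
Compactness: `hVc_hBc_of_cosetTowerC` (abc-iut-w4-d040); the rest: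
`verticialEdgeLikeCompactAmple_outerAction_of_hBR`.
[cite: MochizukiSemiAnbd2006, Rmk 5.3.1, p. 65] -/
theorem verticialEdgeLikeCompactAmple_outerAction_cosetTowerC [CompactSpace PA]
    (h𝒢 : 𝒢.Thm37Hypotheses) (hG : 𝒢.graph.IsGraph) [Finite 𝒢.graph.Vertex] [Finite 𝒢.graph.Branch]
    (R : ChartRepresentatives c)
    -- Prop 3.6 (iv) at `ρ_𝔾(a)` on verticial / edge-like subgroups and on (host, branch-group) pairs,
    -- Def 5.1 (i)(c) for `baseAct` (abc-iut-w4-d082's binders)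
    (hV : ∀ (a : PA) (v : 𝒢.graph.Vertex) (H : Subgroup c.G), H ∈ verticialSubgroups c v →
      ∃ φ : contMulAut c.G, TopOut.mk c.G φ = ρ a ∧
        H.map (φ : MulAut c.G).toMonoidHom ∈ verticialSubgroups c ((baseAct a).hom.vertexMap v))
    (hE : ∀ (a : PA) (e : 𝒢.graph.Edge) (K : Subgroup c.G), K ∈ edgeLikeSubgroups c e →
      ∃ φ : contMulAut c.G, TopOut.mk c.G φ = ρ a ∧
        K.map (φ : MulAut c.G).toMonoidHom ∈ edgeLikeSubgroups c ((baseAct a).hom.edgeMap e))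
    (hopen : ∃ U : Subgroup PA, IsOpen (U : Set PA) ∧ ∀ a ∈ U,
      (∀ v, (baseAct a).hom.vertexMap v = v) ∧ (∀ e, (baseAct a).hom.edgeMap e = e) ∧
        ∀ b, (baseAct a).hom.branchMap b = b)
    (hBR : ∀ (a : PA) (b : 𝒢.graph.Branch) (v : 𝒢.graph.Vertex) (hb : 𝒢.graph.abuts b = some v)
      (φ : 𝒢.Gv v →ₜ* c.G), IsVerticialHom c v φ →
      ∃ Φ : contMulAut c.G, TopOut.mk c.G Φ = ρ a ∧
        ∃ φ' : 𝒢.Gv ((baseAct a).hom.vertexMap v) →ₜ* c.G,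
          IsVerticialHom c ((baseAct a).hom.vertexMap v) φ' ∧ ∃ x' : c.G,
            Subgroup.map (Φ : MulAut c.G).toMonoidHom φ.toMonoidHom.range =
              Subgroup.map (MulAut.conj x').toMonoidHom φ'.toMonoidHom.range ∧
            Subgroup.map (Φ : MulAut c.G).toMonoidHom
                (Subgroup.map φ.toMonoidHom (𝒢.branchSubgroup b v hb)) =
              Subgroup.map (MulAut.conj x').toMonoidHom
                (Subgroup.map φ'.toMonoidHom
                  (𝒢.branchSubgroup ((baseAct a).hom.branchMap b) ((baseAct a).hom.vertexMap v)
                    ((baseAct a).hom.abuts_branchMap b v hb))))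
    -- the subgroup presentation and its compatibility with the outer action (abc-iut-L3-d4)
    (P : SemiGraph.SubgroupPresentation 𝒢.graph c.G) {Φ : outerSemidirectProduct ρ →* MulAut c.G}
    (hP : P.IsArithCompatible Φ (baseAct.comp (outerSemidirectProductSnd ρ)))
    (hιΦ : ∀ g : c.G, Φ (toOuterSemidirectProduct ρ g) = MulAut.conj g)
    (hPH : ∀ w, P.H w ∈ verticialSubgroups c w) (hPM : ∀ e, P.M e ∈ edgeLikeSubgroups c e)
    (w₀ : 𝒢.graph.Vertex)
    -- the tree levels
    (K : ℕ → Subgroup c.G) [∀ j, (K j).Normal] (hK : ∀ ⦃i j : ℕ⦄, i ≤ j → K j ≤ K i)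
    (hKst : ∀ (j : ℕ) (e : outerSemidirectProduct ρ) (x : c.G), x ∈ K j → Φ e x ∈ K j)
    (hTr : ∀ j, (P.cosetGraph (K j)).IsTree)
    (hKopen : ∀ j, IsOpen ((P.arithAct hP (K j) (hKst j)).ker : Set (outerSemidirectProduct ρ)))
    -- Thm 5.4's printed frame hypothesis on the base
    (noSwitchBase : NoBranchSwitching 𝒢.graph.edgeOf
      (fun (a : PA) (b : 𝒢.graph.Branch) => (baseAct a).hom.branchMap b))
    -- abc-iut-w4-d059's dict2 algebraic tower inputs (topological discharge: abc-iut-w4-d085 (P-K))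
    (hHK : ∀ (w : 𝒢.graph.Vertex) (x : c.G), (∀ j, x ∈ (P.H w : Set c.G) * (K j : Set c.G)) → x ∈ P.H w)
    (hMK : ∀ (e : 𝒢.graph.Edge) (x : c.G), (∀ j, x ∈ (P.M e : Set c.G) * (K j : Set c.G)) → x ∈ P.M e)
    (hlift : ∀ (w : 𝒢.graph.Vertex) (y : ℕ → c.G),
      (∀ ⦃i j : ℕ⦄, i ≤ j →
        DoubleCoset.mk (P.H w) (K i) (y j) = DoubleCoset.mk (P.H w) (K i) (y i)) →
      ∃ z : c.G, ∀ j, DoubleCoset.mk (P.H w) (K j) z = DoubleCoset.mk (P.H w) (K j) (y j))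
    (hliftE : ∀ (j₁ : ℕ) (e : 𝒢.graph.Edge) (y : {j : ℕ // j₁ ≤ j} → c.G),
      (∀ ⦃i j : {j : ℕ // j₁ ≤ j}⦄, i.1 ≤ j.1 →
        DoubleCoset.mk (P.M e) (K i.1) (y j) = DoubleCoset.mk (P.M e) (K i.1) (y i)) →
      ∃ z : c.G, ∀ j, DoubleCoset.mk (P.M e) (K j.1) z = DoubleCoset.mk (P.M e) (K j.1) (y j))
    -- the finite levels
    (L : ℕ → Subgroup c.G) [∀ j, (L j).Normal] [∀ j, Finite (c.G ⧸ L j)]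
    (hL : ∀ ⦃i j : ℕ⦄, i ≤ j → L j ≤ L i)
    (hLst : ∀ (j : ℕ) (e : outerSemidirectProduct ρ) (x : c.G), x ∈ L j → Φ e x ∈ L j)
    (hKL : ∀ j, K j ≤ L j)
    (hfree : ∀ (j : ℕ) (w : 𝒢.graph.Vertex) (z x : c.G), x ∈ L j → z * x * z⁻¹ ∈ P.H w → x ∈ K j)
    -- the estrangement consequence at the finite levels, compact form (abc-iut-L3-t11's shape; F-d029g3-1)
    (hnobpNCpt : ∀ (C : Subgroup c.G), IsCompact (C : Set c.G) →
      ∀ (j₀ : ℕ) (w : ∀ i : {i : ℕ // j₀ ≤ i}, (P.cosetGraph (L i.1)).Vertex)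
      (β β' : ∀ i : {i : ℕ // j₀ ≤ i}, (P.cosetGraph (L i.1)).Branch),
      (∀ i, β i ≠ β' i ∧ (P.cosetGraph (L i.1)).abuts (β i) = some (w i) ∧
        (P.cosetGraph (L i.1)).abuts (β' i) = some (w i)) →
      (∀ ⦃i i' : {i : ℕ // j₀ ≤ i}⦄ (h : i.1 ≤ i'.1), (P.cosetGraphTrans (hL h)).vertexMap (w i') = w i ∧
        (P.cosetGraphTrans (hL h)).branchMap (β i') = β i ∧
          (P.cosetGraphTrans (hL h)).branchMap (β' i') = β' i) →
      (∀ (i : {i : ℕ // j₀ ≤ i}) (γ : C),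
        (P.arithAct hP (L i.1) (hLst i.1) (toOuterSemidirectProduct ρ γ)).hom.vertexMap (w i) = w i ∧
        (P.arithAct hP (L i.1) (hLst i.1) (toOuterSemidirectProduct ρ γ)).hom.branchMap (β i) = β i ∧
          (P.arithAct hP (L i.1) (hLst i.1) (toOuterSemidirectProduct ρ γ)).hom.branchMap (β' i) = β' i) →
      C = ⊥)
    -- (AI4″) at the finite levels (abc-iut-w4-d059, producer)
    (stabBranchPairAug : ∀ (C : Subgroup (outerSemidirectProduct ρ)),
      IsCompact (C : Set (outerSemidirectProduct ρ)) →
      ∀ (j₀ : ℕ) (w : ∀ i : {i : ℕ // j₀ ≤ i}, (P.cosetGraph (L i.1)).Vertex)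
      (β β' : ∀ i : {i : ℕ // j₀ ≤ i}, (P.cosetGraph (L i.1)).Branch),
      (∀ i, β i ≠ β' i ∧ (P.cosetGraph (L i.1)).abuts (β i) = some (w i) ∧
        (P.cosetGraph (L i.1)).abuts (β' i) = some (w i)) →
      (∀ ⦃i i' : {i : ℕ // j₀ ≤ i}⦄ (h : i.1 ≤ i'.1), (P.cosetGraphTrans (hL h)).vertexMap (w i') = w i ∧
        (P.cosetGraphTrans (hL h)).branchMap (β i') = β i ∧
          (P.cosetGraphTrans (hL h)).branchMap (β' i') = β' i) →
      (∀ (i : {i : ℕ // j₀ ≤ i}) (g : outerSemidirectProduct ρ), g ∈ C →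
        (P.arithAct hP (L i.1) (hLst i.1) g).hom.vertexMap (w i) = w i ∧
        (P.arithAct hP (L i.1) (hLst i.1) g).hom.branchMap (β i) = β i ∧
          (P.arithAct hP (L i.1) (hLst i.1) g).hom.branchMap (β' i) = β' i) →
      ∃ (v : 𝒢.graph.Vertex) (b b' : 𝒢.graph.Branch) (a : PA) (h : outerSemidirectProduct ρ),
        (decompositionDataOfChart R (toOuterSemidirectProduct ρ)).abut b = some v ∧
        (decompositionDataOfChart R (toOuterSemidirectProduct ρ)).abut b' = some v ∧
        h ∈ (decompositionDataOfChart R (toOuterSemidirectProduct ρ)).vertGp v ∧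
        (b' ≠ b ∨ h ∉ (decompositionDataOfChart R (toOuterSemidirectProduct ρ)).brGp b) ∧
        C.map (outerSemidirectProductSnd ρ) ≤ conjSubgroup a
          (((decompositionDataOfChart R (toOuterSemidirectProduct ρ)).brGp b ⊓
            conjSubgroup h ((decompositionDataOfChart R (toOuterSemidirectProduct ρ)).brGp b')).map
              (outerSemidirectProductSnd ρ)))
    -- the LEVEL-B topology: tempered `E` with abc-iut-L3-d2's basis, `hK1′`, open tree levels
    (hT : IsTempered (outerSemidirectProduct ρ))
    (hb : (𝓝 (1 : outerSemidirectProduct ρ)).HasBasis (fun _ : ℕ × OpenNormalSubgroup PA => True)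
      (fun nU => ((P.levelKer hP (K nU.1) (hKst nU.1) ⊓
        nU.2.toSubgroup.comap (outerSemidirectProductSnd ρ) : Subgroup (outerSemidirectProduct ρ)) :
          Set (outerSemidirectProduct ρ))))
    (hK1' : ∀ n, IsOpen (((P.levelKer hP (K n) (hKst n)).map (outerSemidirectProductSnd ρ) :
      Subgroup PA) : Set PA))
    (hKopen' : ∀ n, IsOpen (K n : Set c.G)) :
    VerticialEdgeLikeCompactAmpleStatement (decompositionDataOfChart R (toOuterSemidirectProduct ρ))
      (outerSemidirectProductSnd ρ) := by
  haveI : Finite 𝒢.graph.Edge := SemiGraph.finite_edge_of_finite_branch 𝒢.graph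
  -- exactness of `1 → π₁^temp → E → Π_A → 1` (temp-slimness)
  obtain ⟨hι, hex, -⟩ := outerAction_exact c ρ h𝒢.toProp36Hypotheses
  have hnorm : ((toOuterSemidirectProduct ρ).range).Normal := by rw [hex]; infer_instance
  have hισ : ∀ g : c.G, (baseAct.comp (outerSemidirectProductSnd ρ)) (toOuterSemidirectProduct ρ g) = 1 :=
    fun g => by
      rw [MonoidHom.comp_apply, outerSemidirectProductSnd_toOuterSemidirectProduct, map_one]
  have hexact : (outerSemidirectProductSnd ρ).ker ≤ (toOuterSemidirectProduct ρ).range := hex ▸ le_rfl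
  obtain ⟨hVc, hBc⟩ := hVc_hBc_of_cosetTowerC c h𝒢 hG R (toOuterSemidirectProduct ρ) hι hnorm
    (outerSemidirectProductSnd ρ) baseAct P hP hιΦ hισ hPH hPM w₀ K hK hKst hTr hKopen noSwitchBase hHK hMK
    hlift hliftE L hL hLst hKL hfree hnobpNCpt stabBranchPairAug hT hb hexact hK1' hKopen'
  exact verticialEdgeLikeCompactAmple_outerAction_of_hBR c ρ baseAct compactInVerticialAt_of_finiteGraph
    h𝒢 hG R hV hE hopen hBR hVc hBc

end ProfiniteSemiGraph

end Literature.AnabelianGeometry.SemiGraphs
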